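import Summits.Ventures.Crystal3D.Theorems.StickyWulffConstantGenericWallFloorRegisteredResidual
import Summits.Ventures.Crystal3D.Theorems.StickyWulffConstantGenericWallFloorCubicCoords
import HarnessLib

/-!
# The registry set is COUNTABLE: `GenericWallFloor` per pair for all but countably many relative translations
# (crux `GenericWallFloor`, stmt-Ventures-19480, line `WallLedgerG`)

HONEST FRAMING. Venture `Summits/Ventures/Crystal3D` (cell `crystal3d-full`), helper `--supports` the crux
`GenericWallFloor` of `route-Ventures-StickyWulffConstant`, REGISTERED line `WallLedgerG`, open stub
`stub_twoSlabAdhesion`.  Packaging only; F-C1 not moved; NOT the crux: `ExactOnly`(C12-55) [E1] and `StarPairFar`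
[certified] stay BY NAME; the countably many REGISTERED translations per pair of frames remain open.

`…OffReach` proves the crux's matrix for every pair of frames and every relative translation off the registry set
`𝓡 = A₁Λ₀ − A₂Λ₀ + reachGroup (chainFrames e₃ A₁ u₁) − reachGroup (chainFrames (−e₃) A₂ u₂)`.  This file proves `𝓡` COUNTABLE:
* `menuNormals_finite` — a frame has finitely many `{111}` menu normals (a normal is determined by its cubic coordinates in
  the frame, `cubicCoords ∘ A⁻¹` injective, and these are `(a ± b)/√2` with `a, b ∈ {0, ±√(2/3)}` by `cubicFrame_eq_slots`);
* `chainFrames_countable` — the forced-ray frame set is the base frame plus `ℕ`-indexed rays over finitely many normals;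
* `addSubgroupClosure_countable`, `reachGroup_countable` — the subgroup generated by a countable set is countable (signed
  list sums); `fccStacking_countable` (range over `ℤ³`); `registrySet`, `registrySet_countable`;
* **`genericWallFloorAt_off_countable`** — for EVERY pair of frames `A₁, A₂` there is a COUNTABLE set `S ⊆ ℝ³` such that
  `GenericWallFloorAt A₁ t₁ A₂ t₂` (the route decl's matrix, `c₀ = 1`) holds whenever `t₂ − t₁ ∉ S`, modulo
  `ExactOnly`(C12-55) and `StarPairFar`.  In words: the wall floor of lane G is proved for all but countably many relative
  translations of ANY two grains; the ray-aligned core of the crux is a countable family of exact registries per orientation.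
WHAT THIS IS NOT: not the stub (the registries are where coherent lamellae live); F-C1 not moved.
-/

noncomputable section

namespace Summit.Ventures.Crystal3D.Theorems

open Summit.Ventures.Crystal3D Finset
open Literature.MathematicalPhysics.StatisticalMechanics (fccStacking barlowStacking barlowPos constHagg IsHaggSeq)
open scoped InnerProductSpace

/-! ### Finitely many menu normals -/

/-- **A frame has finitely many `{111}` menu normals** (vectors `n` with `⟪A w, n⟫ ∈ {0, ±√(2/3)}` for every slot `w`). -/
theorem menuNormals_finite (A : EuclideanSpace ℝ (Fin 3) ≃ₗᵢ[ℝ] EuclideanSpace ℝ (Fin 3)) :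
    {n : EuclideanSpace ℝ (Fin 3) | ∀ w ∈ fccSlots,
      ⟪A w, n⟫_ℝ = 0 ∨ ⟪A w, n⟫_ℝ = Real.sqrt (2 / 3) ∨ ⟪A w, n⟫_ℝ = -Real.sqrt (2 / 3)}.Finite := by
  classical
  set V : Set ℝ := {0, Real.sqrt (2 / 3), -Real.sqrt (2 / 3)} with hV
  have hVf : V.Finite := by rw [hV]; exact Set.toFinite _
  set T : Set ℝ := (fun p : ℝ × ℝ => 1 / Real.sqrt 2 * (p.1 + p.2)) '' (V ×ˢ V) ∪
    (fun p : ℝ × ℝ => 1 / Real.sqrt 2 * (p.1 - p.2)) '' (V ×ˢ V) with hT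
  have hTf : T.Finite := ((hVf.prod hVf).image _).union ((hVf.prod hVf).image _)
  set f : EuclideanSpace ℝ (Fin 3) → (Fin 3 → ℝ) := fun n => cubicCoords (A.symm n) with hf
  have hfinj : Function.Injective f := fun n n' h => A.symm.injective (cubicCoords_injective h)
  have hpi : {g : Fin 3 → ℝ | ∀ i, g i ∈ T}.Finite := Set.Finite.pi' fun _ => hTf
  refine (Set.Finite.preimage hfinj.injOn hpi).subset ?_
  intro n hn
  simp only [Set.mem_preimage, Set.mem_setOf_eq]
  have key : ∀ i, f n i = ⟪n, A (cubicFrame i)⟫_ℝ := by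
    intro i
    simp only [hf]
    rw [← inner_cubicFrame, ← A.inner_map_map, A.apply_symm_apply]
  have hval : ∀ k : Fin 12, ⟪n, A (slotSite k)⟫_ℝ ∈ V := by
    intro k
    have h := hn (slotSite k) (slotSite_mem k)
    rw [real_inner_comm] at h
    rw [hV]
    rcases h with h | h | h
    · exact Or.inl h
    · exact Or.inr (Or.inl h)
    · exact Or.inr (Or.inr h)
  obtain ⟨h0, h1, h2⟩ := cubicFrame_eq_slots
  have hcoord : ∀ i : Fin 3, ⟪n, A (cubicFrame i)⟫_ℝ ∈ T := by
    intro i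
    fin_cases i
    · show ⟪n, A (cubicFrame 0)⟫_ℝ ∈ T
      refine Or.inl ⟨(⟪n, A (slotSite 0)⟫_ℝ, ⟪n, A (slotSite 1)⟫_ℝ), Set.mk_mem_prod (hval 0) (hval 1), ?_⟩
      show 1 / Real.sqrt 2 * (⟪n, A (slotSite 0)⟫_ℝ + ⟪n, A (slotSite 1)⟫_ℝ) = ⟪n, A (cubicFrame 0)⟫_ℝ
      rw [h0, map_smul, map_add, real_inner_smul_right, inner_add_right]
    · show ⟪n, A (cubicFrame 1)⟫_ℝ ∈ T
      refine Or.inr ⟨(⟪n, A (slotSite 0)⟫_ℝ, ⟪n, A (slotSite 1)⟫_ℝ), Set.mk_mem_prod (hval 0) (hval 1), ?_⟩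
      show 1 / Real.sqrt 2 * (⟪n, A (slotSite 0)⟫_ℝ - ⟪n, A (slotSite 1)⟫_ℝ) = ⟪n, A (cubicFrame 1)⟫_ℝ
      rw [h1, map_smul, map_sub, real_inner_smul_right, inner_sub_right]
    · show ⟪n, A (cubicFrame 2)⟫_ℝ ∈ T
      refine Or.inr ⟨(⟪n, A (slotSite 4)⟫_ℝ, ⟪n, A (slotSite 5)⟫_ℝ), Set.mk_mem_prod (hval 4) (hval 5), ?_⟩
      show 1 / Real.sqrt 2 * (⟪n, A (slotSite 4)⟫_ℝ - ⟪n, A (slotSite 5)⟫_ℝ) = ⟪n, A (cubicFrame 2)⟫_ℝ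
      rw [h2, map_smul, map_sub, real_inner_smul_right, inner_sub_right]
  intro i
  rw [key]
  exact hcoord i

/-- **The forced-ray frame set is countable**: the base frame plus two `ℕ`-indexed rays per admissible normal. -/
theorem chainFrames_countable (z : EuclideanSpace ℝ (Fin 3)) (A : EuclideanSpace ℝ (Fin 3) ≃ₗᵢ[ℝ] EuclideanSpace ℝ (Fin 3))
    (u : EuclideanSpace ℝ (Fin 3)) : (chainFrames z A u).Countable := by
  have hsub : chainFrames z A u ⊆ {A} ∪ ⋃ n ∈ {n : EuclideanSpace ℝ (Fin 3) | ∀ w ∈ fccSlots,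
      ⟪A w, n⟫_ℝ = 0 ∨ ⟪A w, n⟫_ℝ = Real.sqrt (2 / 3) ∨ ⟪A w, n⟫_ℝ = -Real.sqrt (2 / 3)},
      Set.range (fun k : ℕ => (forcedTop z ⟨A, u, 0⟩ n k).frame) := by
    intro F hF
    rcases hF with rfl | ⟨n, -, hmenu, -, k, rfl⟩
    · exact Or.inl rfl
    · exact Or.inr (Set.mem_biUnion (show n ∈ {n : EuclideanSpace ℝ (Fin 3) | _} from hmenu) ⟨k, rfl⟩)
  exact Set.Countable.mono hsub ((Set.countable_singleton A).union
    ((menuNormals_finite A).countable.biUnion fun n _ => Set.countable_range _))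

/-! ### Countable generation -/

/-- Negating every summand negates a list sum. -/
private theorem sum_map_neg_eq {α : Type*} (l : List α) (f : α → EuclideanSpace ℝ (Fin 3)) :
    (l.map fun a => -f a).sum = -(l.map f).sum := by
  induction l with
  | nil => simp
  | cons a l ih => rw [List.map_cons, List.sum_cons, List.map_cons, List.sum_cons, ih, neg_add]

/-- **The additive subgroup generated by a countable set is countable** (every element is a signed sum of a finite list of
generators). -/
theorem addSubgroupClosure_countable {G : Set (EuclideanSpace ℝ (Fin 3))} (hG : G.Countable) :
    ((AddSubgroup.closure G : AddSubgroup (EuclideanSpace ℝ (Fin 3))) : Set (EuclideanSpace ℝ (Fin 3))).Countable := by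
  classical
  haveI : Countable G := hG.to_subtype
  let sgn : G × Bool → EuclideanSpace ℝ (Fin 3) := fun p => if p.2 then (p.1 : EuclideanSpace ℝ (Fin 3)) else -(p.1 : _)
  let g : List (G × Bool) → EuclideanSpace ℝ (Fin 3) := fun l => (l.map sgn).sum
  refine (Set.countable_range g).mono ?_
  intro x hx
  refine AddSubgroup.closure_induction (p := fun x _ => x ∈ Set.range g) ?_ ?_ ?_ ?_ hx
  · intro y hy
    exact ⟨[(⟨y, hy⟩, true)], by simp [g, sgn]⟩
  · exact ⟨[], by simp [g]⟩
  · rintro y y' - - ⟨l, rfl⟩ ⟨l', rfl⟩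
    exact ⟨l ++ l', by simp [g, List.map_append, List.sum_append]⟩
  · rintro y - ⟨l, rfl⟩
    refine ⟨l.map fun p => (p.1, !p.2), ?_⟩
    have hflip : (sgn ∘ fun p : G × Bool => (p.1, !p.2)) = fun p => -sgn p := by
      funext p
      rcases p with ⟨a, b⟩
      cases b <;> simp [sgn]
    show ((l.map fun p => (p.1, !p.2)).map sgn).sum = -(l.map sgn).sum
    rw [List.map_map, hflip, sum_map_neg_eq]

/-- **The reach group of a countable frame set is countable.** -/
theorem reachGroup_countable {M : Set (EuclideanSpace ℝ (Fin 3) ≃ₗᵢ[ℝ] EuclideanSpace ℝ (Fin 3))} (hM : M.Countable) :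
    ((reachGroup M : AddSubgroup (EuclideanSpace ℝ (Fin 3))) : Set (EuclideanSpace ℝ (Fin 3))).Countable := by
  classical
  refine addSubgroupClosure_countable ?_
  have hsub : {v : EuclideanSpace ℝ (Fin 3) | ∃ F ∈ M, ∃ w ∈ fccSlots, v = F w} ⊆
      ⋃ F ∈ M, Set.range (fun w : ↥fccSlots => F (w : EuclideanSpace ℝ (Fin 3))) := by
    rintro v ⟨F, hF, w, hw, rfl⟩
    exact Set.mem_biUnion hF ⟨⟨w, hw⟩, rfl⟩
  exact Set.Countable.mono hsub (hM.biUnion fun F _ => Set.countable_range _)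

/-- The fcc lattice is countable (a range over `ℤ³`). -/
theorem fccStacking_countable : (fccStacking 1 (Real.sqrt (2 / 3))).Countable := by
  have hsub : fccStacking 1 (Real.sqrt (2 / 3)) ⊆
      Set.range (fun p : ℤ × ℤ × ℤ => barlowPos 1 (Real.sqrt (2 / 3)) constHagg p.1 p.2.1 p.2.2) := by
    intro x hx
    obtain ⟨k, i, j, rfl⟩ := hx
    exact ⟨(k, i, j), rfl⟩
  exact (Set.countable_range _).mono hsub

/-! ### The registry set -/

/-- **The REGISTRY SET** of a pair of frames with frame sets `M₁`, `M₂`: the relative translations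
`A₁x₁ − A₂x₂ + v₁ − v₂` (`xᵢ ∈ Λ₀`, `vᵢ ∈ reachGroup Mᵢ`) at which the two reach sets can meet (`reachSet_disjoint_iff`). -/
def registrySet (A₁ A₂ : EuclideanSpace ℝ (Fin 3) ≃ₗᵢ[ℝ] EuclideanSpace ℝ (Fin 3))
    (M₁ M₂ : Set (EuclideanSpace ℝ (Fin 3) ≃ₗᵢ[ℝ] EuclideanSpace ℝ (Fin 3))) : Set (EuclideanSpace ℝ (Fin 3)) :=
  {d | ∃ x₁ ∈ fccStacking 1 (Real.sqrt (2 / 3)), ∃ x₂ ∈ fccStacking 1 (Real.sqrt (2 / 3)),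
    ∃ v₁ ∈ reachGroup M₁, ∃ v₂ ∈ reachGroup M₂, d = A₁ x₁ - A₂ x₂ + v₁ - v₂}

/-- **The registry set of countable frame sets is countable.** -/
theorem registrySet_countable (A₁ A₂ : EuclideanSpace ℝ (Fin 3) ≃ₗᵢ[ℝ] EuclideanSpace ℝ (Fin 3))
    {M₁ M₂ : Set (EuclideanSpace ℝ (Fin 3) ≃ₗᵢ[ℝ] EuclideanSpace ℝ (Fin 3))} (hM₁ : M₁.Countable) (hM₂ : M₂.Countable) :
    (registrySet A₁ A₂ M₁ M₂).Countable := by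
  have hprod := ((fccStacking_countable.prod fccStacking_countable).prod
    ((reachGroup_countable hM₁).prod (reachGroup_countable hM₂))).image
    (fun q : (EuclideanSpace ℝ (Fin 3) × EuclideanSpace ℝ (Fin 3)) × (EuclideanSpace ℝ (Fin 3) × EuclideanSpace ℝ (Fin 3)) =>
      A₁ q.1.1 - A₂ q.1.2 + q.2.1 - q.2.2)
  refine hprod.mono ?_
  rintro d ⟨x₁, hx₁, x₂, hx₂, v₁, hv₁, v₂, hv₂, rfl⟩
  exact ⟨((x₁, x₂), (v₁, v₂)), ⟨⟨hx₁, hx₂⟩, ⟨hv₁, hv₂⟩⟩, rfl⟩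

/-- Off the registry set the reach sets are disjoint. -/
theorem reachSet_disjoint_of_not_mem_registrySet {A₁ A₂ : EuclideanSpace ℝ (Fin 3) ≃ₗᵢ[ℝ] EuclideanSpace ℝ (Fin 3)}
    {t₁ t₂ : EuclideanSpace ℝ (Fin 3)} {M₁ M₂ : Set (EuclideanSpace ℝ (Fin 3) ≃ₗᵢ[ℝ] EuclideanSpace ℝ (Fin 3))}
    (h : t₂ - t₁ ∉ registrySet A₁ A₂ M₁ M₂) : ∀ y ∈ reachSet A₁ t₁ M₁, y ∉ reachSet A₂ t₂ M₂ :=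
  reachSet_disjoint_iff.2 fun x₁ hx₁ x₂ hx₂ v₁ hv₁ v₂ hv₂ heq => h ⟨x₁, hx₁, x₂, hx₂, v₁, hv₁, v₂, hv₂, heq⟩

/-! ### The countable-exception theorem -/

open scoped Classical in
/-- **`GenericWallFloor` per pair for all but COUNTABLY many relative translations.**  For every pair of frames `A₁, A₂`
there is a countable `S ⊆ ℝ³` (the registry set of a steep slot pair) such that the route decl's matrix
`GenericWallFloorAt A₁ t₁ A₂ t₂` (`c₀ = 1`) holds whenever `t₂ − t₁ ∉ S`; modulo `ExactOnly`(C12-55) and `StarPairFar`. -/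
theorem genericWallFloorAt_off_countable
    {s₀ : EuclideanSpace ℝ (Fin 3)} (hs₀ : s₀ ∈ fccSlots)
    (hcert : ExactOnly 0 (fccSlots.filter fun w => 0 < ⟪w, s₀⟫_ℝ)) (hfar : StarPairFar)
    (A₁ A₂ : EuclideanSpace ℝ (Fin 3) ≃ₗᵢ[ℝ] EuclideanSpace ℝ (Fin 3)) :
    ∃ S : Set (EuclideanSpace ℝ (Fin 3)), S.Countable ∧
      ∀ t₁ t₂ : EuclideanSpace ℝ (Fin 3), t₂ - t₁ ∉ S → GenericWallFloorAt A₁ t₁ A₂ t₂ := by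
  obtain ⟨u₁, hu₁, hsteep₁⟩ := exists_steep_slot_up A₁
  obtain ⟨u₂, hu₂, hsteep₂⟩ := exists_steep_slot_down A₂
  refine ⟨registrySet A₁ A₂ (chainFrames (EuclideanSpace.single (2 : Fin 3) (1 : ℝ)) A₁ u₁)
      (chainFrames (-EuclideanSpace.single (2 : Fin 3) (1 : ℝ)) A₂ u₂),
    registrySet_countable A₁ A₂ (chainFrames_countable _ _ _) (chainFrames_countable _ _ _), fun t₁ t₂ ht => ?_⟩
  exact genericWallFloorAt_offReach hs₀ hcert hfar A₁ t₁ A₂ t₂ hu₁ hsteep₁ hu₂ hsteep₂ _ _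
    (fun _ hS hW hlast => frame_mem_chainFrames_of_stack hS hW hlast)
    (fun _ hS hW hlast => frame_mem_chainFrames_of_stack hS hW hlast)
    (reachSet_disjoint_of_not_mem_registrySet ht)

/-- **Registered pairs have their relative translation in every steep registry set** (the converse reading of
`RegisteredAt`): the residual of lane G lives on countably many translations per pair of frames. -/
theorem sub_mem_registrySet_of_registeredAt {A₁ : EuclideanSpace ℝ (Fin 3) ≃ₗᵢ[ℝ] EuclideanSpace ℝ (Fin 3)}
    {t₁ : EuclideanSpace ℝ (Fin 3)} {A₂ : EuclideanSpace ℝ (Fin 3) ≃ₗᵢ[ℝ] EuclideanSpace ℝ (Fin 3)}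
    {t₂ : EuclideanSpace ℝ (Fin 3)} (h : RegisteredAt A₁ t₁ A₂ t₂)
    {u₁ : EuclideanSpace ℝ (Fin 3)} (hu₁ : u₁ ∈ fccSlots)
    (hsteep₁ : Real.sqrt 2 / 2 ≤ ⟪A₁ u₁, EuclideanSpace.single (2 : Fin 3) (1 : ℝ)⟫_ℝ)
    {u₂ : EuclideanSpace ℝ (Fin 3)} (hu₂ : u₂ ∈ fccSlots)
    (hsteep₂ : ⟪A₂ u₂, EuclideanSpace.single (2 : Fin 3) (1 : ℝ)⟫_ℝ ≤ -(Real.sqrt 2 / 2)) :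
    t₂ - t₁ ∈ registrySet A₁ A₂ (chainFrames (EuclideanSpace.single (2 : Fin 3) (1 : ℝ)) A₁ u₁)
      (chainFrames (-EuclideanSpace.single (2 : Fin 3) (1 : ℝ)) A₂ u₂) := by
  by_contra hnot
  obtain ⟨y, hy₁, hy₂⟩ := h u₁ hu₁ hsteep₁ u₂ hu₂ hsteep₂
  exact reachSet_disjoint_of_not_mem_registrySet hnot y hy₁ hy₂

/-- **The registered translations are countable**: for fixed frames and `t₁`, the set of `t₂` for which the pair is
REGISTERED (`RegisteredAt`, `…RegisteredResidual`) is countable — the registered residual of lane G concerns, per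
`(A₁, t₁, A₂)`, at most countably many positions of the far grain. -/
theorem registeredAt_countable (A₁ : EuclideanSpace ℝ (Fin 3) ≃ₗᵢ[ℝ] EuclideanSpace ℝ (Fin 3)) (t₁ : EuclideanSpace ℝ (Fin 3))
    (A₂ : EuclideanSpace ℝ (Fin 3) ≃ₗᵢ[ℝ] EuclideanSpace ℝ (Fin 3)) :
    {t₂ : EuclideanSpace ℝ (Fin 3) | RegisteredAt A₁ t₁ A₂ t₂}.Countable := by
  obtain ⟨u₁, hu₁, hsteep₁⟩ := exists_steep_slot_up A₁
  obtain ⟨u₂, hu₂, hsteep₂⟩ := exists_steep_slot_down A₂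
  have hR := registrySet_countable A₁ A₂ (chainFrames_countable (EuclideanSpace.single (2 : Fin 3) (1 : ℝ)) A₁ u₁)
    (chainFrames_countable (-EuclideanSpace.single (2 : Fin 3) (1 : ℝ)) A₂ u₂)
  refine (hR.image fun d => t₁ + d).mono ?_
  intro t₂ ht₂
  exact ⟨t₂ - t₁, sub_mem_registrySet_of_registeredAt ht₂ hu₁ hsteep₁ hu₂ hsteep₂, by abel⟩

/-- **Summary form.**  For every `(A₁, t₁, A₂)` the crux's matrix `GenericWallFloorAt A₁ t₁ A₂ t₂` holds for all `t₂`
outside a countable set (modulo `ExactOnly`(C12-55) and `StarPairFar`). -/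
theorem genericWallFloorAt_forall_off_countable
    {s₀ : EuclideanSpace ℝ (Fin 3)} (hs₀ : s₀ ∈ fccSlots)
    (hcert : ExactOnly 0 (fccSlots.filter fun w => 0 < ⟪w, s₀⟫_ℝ)) (hfar : StarPairFar)
    (A₁ : EuclideanSpace ℝ (Fin 3) ≃ₗᵢ[ℝ] EuclideanSpace ℝ (Fin 3)) (t₁ : EuclideanSpace ℝ (Fin 3))
    (A₂ : EuclideanSpace ℝ (Fin 3) ≃ₗᵢ[ℝ] EuclideanSpace ℝ (Fin 3)) :
    ∃ S : Set (EuclideanSpace ℝ (Fin 3)), S.Countable ∧ ∀ t₂ ∉ S, GenericWallFloorAt A₁ t₁ A₂ t₂ :=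
  ⟨{t₂ | RegisteredAt A₁ t₁ A₂ t₂}, registeredAt_countable A₁ t₁ A₂,
    fun _ ht₂ => genericWallFloorAt_of_not_registeredAt hs₀ hcert hfar ht₂⟩

end Summit.Ventures.Crystal3D.Theorems

end
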